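import Literature.Analysis.FluidPDE.OnsagerBDSVEnergy
import HarnessLib

/-!
# The BDSV perturbation: the bounds of Cor. 5.8 on `w_o` and `w_c` as named facts

Buckmaster–De Lellis–Székelyhidi–Vicol (BDSV), *Onsager's conjecture for admissible weak
solutions*, CPAM 72 (2019) = arXiv:1701.08678, Cor. 5.8:

> Assuming `a` is sufficiently large, the perturbations `w_o`, `w_c` and `w_q` satisfy the following
> estimates
> (arXiv (5.29)) `‖w_o‖₀ + λ_{q+1}⁻¹ ‖w_o‖₁ ≤ (M/4) δ_{q+1}^{1/2}`,
> (arXiv (5.30)) `‖w_c‖₀ + λ_{q+1}⁻¹ ‖w_c‖₁ ≲ δ_{q+1}^{1/2} ℓ⁻¹ λ_{q+1}^{N-1}` [sic],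
> (arXiv (5.31)) `‖w_{q+1}‖₀ + λ_{q+1}⁻¹ ‖w_{q+1}‖₁ ≤ (M/2) δ_{q+1}^{1/2}`,
> where the constant `M` depends solely on the constant `c₀` in (5.16).

(5.31) is the named fact `BDSV.incrementEstimate` (F₄ of `OnsagerBDSVPerturbation.lean`). The two
bounds on the parts of the split `w_{q+1} = w_o + w_c` — `w_o = BDSV.principalPart`,
`w_c = BDSV.correctorPart` (`OnsagerBDSVEnergy.lean`) — are what the oscillation term `𝒪₂` of
§6.1.3 (arXiv (6.9), `BDSV.oscillationCorrectorEstimate`) and the corrector term of the energy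
(`BDSV.energy_correctorTerm`) consume; this file transcribes them as **named facts** along the
common prefix `BDSV.StageFact`:

* `BDSV.principalPartBound` (arXiv (5.29)) and `BDSV.correctorPartBound` (arXiv (5.30)).

## Transcription

* Norms: `‖·‖₀` and `[·]₁ = maxᵢ ‖∂ᵢ·‖₀` on `[0,T] × T³` are the pointwise predicates `BDSV.SupLE`,
  `BDSV.DerivSupLE` of `OnsagerBDSV.lean` (as in `BDSV.InductiveEstimates`,
  `BDSV.VelocityIncrementBound`); `‖·‖₁ = ‖·‖₀ + [·]₁`. Each printed line `‖f‖₀ + λ⁻¹‖f‖₁ ≤ B` is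
  transcribed as the pair `‖f‖₀ ≤ B`, `[f]₁ ≤ λ_{q+1} B` it implies (and which implies it with `3B`).
* Constants: along `BDSV.StageFact` the constant is an existential `C` fixed before the threshold
  `a₀`; for (5.29) this is WEAKER than the printed `M/4` with the universal `M` of Def. 5.6 (which
  matters for (5.31) and the induction, not for the uses of (5.29) in §6), and for (5.30) it is
  the implicit constant of `≲` ("depending on `β, α, M`", proof of Cor. 5.8).
* (5.30) prints the power `λ_{q+1}^{N-1}`; its two-line proof ("a direct consequence of (5.26) and
  (5.33)": `‖c_{i,k}‖_N ≲ δ_{q+1}^{1/2} λ_{q+1}⁻¹ |k|⁻⁶ ℓ^{-N-1}`, `‖∇e^{iλ_{q+1}k·Φ_i}‖₀ ≤ 2λ_{q+1}|k|`)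
  gives `λ_{q+1}^{-1}` (`‖w_c‖₀ ≲ δ_{q+1}^{1/2}ℓ⁻¹λ_{q+1}⁻¹`, `‖w_c‖₁ ≲ δ_{q+1}^{1/2}ℓ⁻¹(1 + (ℓλ_{q+1})⁻¹)
  ≲ δ_{q+1}^{1/2}ℓ⁻¹` by (6.4)), which is also how (5.30) is used in §6.1.3 and §6.2
  ("`‖w_c‖₀ ≲ δ_{q+1}^{1/2} ℓ⁻¹ λ_{q+1}⁻¹`", cf. `BDSV.energy_correctorTerm`); the `N` is a misprint
  and the transcription carries `λ_{q+1}^{-1}`.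

## References

* T. Buckmaster, C. De Lellis, L. Székelyhidi Jr., V. Vicol, *Onsager's conjecture for admissible
  weak solutions*, Comm. Pure Appl. Math. 72 (2019) 229–274 = arXiv:1701.08678, §5.5 Cor. 5.8
  (arXiv (5.29)–(5.31)) and its proof (arXiv (5.32)–(5.36)); §5.3 (arXiv (5.20), (5.27)–(5.28)).
  Equation numbers as in arXiv:1701.08678v1 (cf. `OnsagerBDSVStressSplit.lean`, "Numbering").
-/

open MeasureTheory Set
open scoped NNReal ENNReal ContDiff Matrix Matrix.Norms.Elementwise

noncomputable section

namespace Literature.Analysis.FluidPDE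

namespace BDSV

open FunctionSpaces FunctionSpaces.Torus

/-- **Cor. 5.8, the principal part** (arXiv (5.29): "`‖w_o‖₀ + λ_{q+1}⁻¹‖w_o‖₁ ≤ (M/4)δ_{q+1}^{1/2}`",
for `a` sufficiently large; proof arXiv (5.32)–(5.35): `‖(∇Φ_i)⁻¹‖₀ ≤ 2` on `supp η_i`, disjoint
supports of the `w_{o,i}`, Lemma 5.5, `‖∇e^{iλ_{q+1}k·Φ_i}‖₀ ≤ 2λ_{q+1}|k|`, Prop. 5.7 and
`(ℓλ_{q+1})⁻¹ ≤ …` for `b > (1-β+3α/2)/(1-β)`, `a` large). Transcription (module docstring): along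
`BDSV.StageFact`, for `w_o = BDSV.principalPart`, `‖w_o‖₀ ≤ C δ_{q+1}^{1/2}` and
`[w_o]₁ ≤ C δ_{q+1}^{1/2} λ_{q+1}` on `[0,T] × T³` (`BDSV.SupLE`, `BDSV.DerivSupLE`), with an
existential constant `C` in place of the printed `M/4`. [cite: BuckmasterEtAl2018, Cor. 5.8 (arXiv (5.29))] -/
def principalPartBound : Prop :=
  StageFact fun 𝔚 P C S _ _ 𝒟 =>
    SupLE S.T (principalPart P S 𝔚 𝒟.cut.η 𝒟.D) (C * Real.sqrt (amp P.β P.a P.b (S.q + 1))) ∧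
      DerivSupLE S.T (principalPart P S 𝔚 𝒟.cut.η 𝒟.D)
        (C * (Real.sqrt (amp P.β P.a P.b (S.q + 1)) * freq P.a P.b (S.q + 1)))

/-- **Cor. 5.8, the corrector** (arXiv (5.30): "`‖w_c‖₀ + λ_{q+1}⁻¹‖w_c‖₁ ≲ δ_{q+1}^{1/2}ℓ⁻¹λ_{q+1}^{N-1}`"
[sic; the proof and all uses have `λ_{q+1}^{-1}`, module docstring]; proof: "a direct consequence
of (5.26) and (5.33)"). Transcription (module docstring): along `BDSV.StageFact`, for
`w_c = BDSV.correctorPart`, `‖w_c‖₀ ≤ C δ_{q+1}^{1/2} ℓ⁻¹ λ_{q+1}⁻¹` and `[w_c]₁ ≤ C δ_{q+1}^{1/2} ℓ⁻¹`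
on `[0,T] × T³`, `ℓ = BDSV.mollScale`. [cite: BuckmasterEtAl2018, Cor. 5.8 (arXiv (5.30))] -/
def correctorPartBound : Prop :=
  StageFact fun 𝔚 P C S _ _ 𝒟 =>
    SupLE S.T (correctorPart P S 𝔚 𝒟.cut.η 𝒟.D)
        (C * (Real.sqrt (amp P.β P.a P.b (S.q + 1)) * (mollScale P.β P.α P.a P.b S.q)⁻¹ *
          (freq P.a P.b (S.q + 1))⁻¹)) ∧
      DerivSupLE S.T (correctorPart P S 𝔚 𝒟.cut.η 𝒟.D)
        (C * (Real.sqrt (amp P.β P.a P.b (S.q + 1)) * (mollScale P.β P.α P.a P.b S.q)⁻¹))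

end BDSV

end Literature.Analysis.FluidPDE
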